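import Mathlib
import Summits.ValiantsHypothesis.ValiantsHypothesis.Theorems.FifoMatchingNNMonotoneExpBound
import HarnessLib

/-!
# The thick-queue engine, abstract form: ANY cost function obeying the spread law is `≥ 2^{n^{1/6}}` eventually

Route `ValiantsHypothesis/FifoMatching`, helper toward crux stmt-ValiantsHypothesis-21181 (`NNDivisionHard`), used by the
sibling `FifoMatchingNNPowersNotCertificates.lean`.

The tree's `NNMonotoneExpBound.exp_lower_bound` (support item 22994) derives `2^{n^{1/6}} ≤ L₊(NN_n)` from TWO inputs:
the thick-queue measures at every large length (`exists_thick_measure_of_le`) and the union bound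
`one_le_complexity_mul_of_spread` (`1 ≤ 4 L₊(NN_n) (n+1)² β` whenever a probability weighting of the nest-free perfect
matchings gives every balanced vertex split mass `≤ β`).  This file ABSTRACTS the second input: for any `F : ℕ → ℕ`
satisfying the same SPREAD LAW (`1 ≤ 4 F(n) (n+1)² β` under the same hypothesis, `n ≥ 3`), `2^{n^{1/6}} ≤ F(n)` for all
large `n` (★ `exp_lower_bound_of_spreadLaw`; the proof is the tree's, verbatim, with `L₊(NN_n)` replaced by `F n`).
Instances: `F n = L₊(NN_n)` (the original, `NNMonotoneExpBound.exp_lower_bound`), and — in the sibling —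
`F n = min_{M ≥ 1} L₊(NN_n^M)` (powers are not certificates).

HONEST FRAMING: monotone-world engine; nothing here is a route statement; VP ≠ VNP is NOT proved.
Adapted from `Theorems/FifoMatchingNNMonotoneExpBound.lean` (`exp_lower_bound`).
-/

noncomputable section

-- Sub = Summit single-conjunct layout: the duplicated namespace component is mandated by the tree.
set_option linter.dupNamespace false

namespace Summit.ValiantsHypothesis.ValiantsHypothesis.Theorems.FifoMatching

namespace SpreadLaw

open Finset Filter Literature.Computability.AlgebraicComplexity
open Summit.ValiantsHypothesis.ValiantsHypothesis.Theorems.FifoMatching.NNMonotoneHard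
open Summit.ValiantsHypothesis.ValiantsHypothesis.Theorems.FifoMatching.NNMonotoneExpBound
open scoped NNReal Topology

/-- ★ **The thick-queue engine for an abstract cost.**  If `F : ℕ → ℕ` obeys the SPREAD LAW — for every `n ≥ 3`, every
probability weighting `μ` of the nest-free perfect matchings of `[2n]` and every `β` bounding the mass of every balanced
vertex split (`2n < 3|S| ≤ 4n`, event `∀ i, i ∈ S ↔ M i ∈ S`), `1 ≤ 4 · F(n) · (n+1)² · β` — then `2^{n^{1/6}} ≤ F(n)` for
all large `n` (thick-queue measures at every large length, `exists_thick_measure_of_le`). [folklore] -/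
theorem exp_lower_bound_of_spreadLaw (F : ℕ → ℕ)
    (hF : ∀ n : ℕ, 3 ≤ n → ∀ (β : ℝ≥0) (μ : (Fin (2 * n) → Fin (2 * n)) → ℝ≥0),
      (∑ M ∈ nestFreeMatchings (2 * n), μ M = 1) →
      (∀ S : Finset (Fin (2 * n)), 2 * n < 3 * S.card → 3 * S.card ≤ 4 * n →
        (∑ M ∈ (nestFreeMatchings (2 * n)).filter (fun M => ∀ i, i ∈ S ↔ M i ∈ S), μ M) ≤ β) →
      (1 : ℝ) ≤ 4 * (F n : ℝ) * ((n : ℝ) + 1) ^ 2 * (β : ℝ)) :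
    ∃ n₀ : ℕ, ∀ n : ℕ, n₀ ≤ n → (2 : ℝ) ^ ((n : ℝ) ^ ((1 : ℝ) / 6)) ≤ (F n : ℝ) := by
  -- the two asymptotic requirements and `u ≥ 13600`, eventually in `u`
  have hexp0 : 0 ≤ Real.exp (-(1 / 54400 : ℝ)) := (Real.exp_pos _).le
  have hexp1 : Real.exp (-(1 / 54400 : ℝ)) < 1 := Real.exp_lt_one_iff.2 (by norm_num)
  have E1 := eventually_const_mul_pow_mul_pow_lt 10 (C := 4 * 27200 ^ 2) hexp0 hexp1 one_pos
  have E2 := eventually_const_mul_pow_mul_pow_lt 15 (C := 4 * 13601 ^ 2 * 54400)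
    (a := 81 / 128) (by norm_num) (by norm_num) one_pos
  obtain ⟨u₀, hu₀⟩ := Filter.eventually_atTop.1 ((eventually_ge_atTop 13600).and (E1.and E2))
  -- threshold `T(u) = 192u⁵ + 176u⁴ + 29u³ + 24u + 4`; `n₀ := T(u₀)`
  refine ⟨192 * u₀ ^ 5 + 176 * u₀ ^ 4 + 29 * u₀ ^ 3 + 24 * u₀ + 4, fun n hn => ?_⟩
  -- choose `u`: the largest with `T(u) ≤ n`
  set u : ℕ := Nat.findGreatest
    (fun u => 192 * u ^ 5 + 176 * u ^ 4 + 29 * u ^ 3 + 24 * u + 4 ≤ n) n with hu_def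
  have hu₀n : u₀ ≤ n := le_trans (by omega) hn
  have hu₀u : u₀ ≤ u :=
    Nat.le_findGreatest (P := fun u => 192 * u ^ 5 + 176 * u ^ 4 + 29 * u ^ 3 + 24 * u + 4 ≤ n)
      hu₀n hn
  have hTu : 192 * u ^ 5 + 176 * u ^ 4 + 29 * u ^ 3 + 24 * u + 4 ≤ n :=
    Nat.findGreatest_spec (P := fun u => 192 * u ^ 5 + 176 * u ^ 4 + 29 * u ^ 3 + 24 * u + 4 ≤ n)
      hu₀n hn
  have hule : u ≤ n :=
    Nat.findGreatest_le (P := fun u => 192 * u ^ 5 + 176 * u ^ 4 + 29 * u ^ 3 + 24 * u + 4 ≤ n) n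
  have hun : u < n := by
    rcases hule.eq_or_lt with h | h
    · exfalso
      have hTu' := hTu
      rw [h] at hTu'
      omega
    · exact h
  have hTu1 : ¬ (192 * (u + 1) ^ 5 + 176 * (u + 1) ^ 4 + 29 * (u + 1) ^ 3 + 24 * (u + 1) + 4 ≤ n) :=
    Nat.findGreatest_is_greatest
      (P := fun u => 192 * u ^ 5 + 176 * u ^ 4 + 29 * u ^ 3 + 24 * u + 4 ≤ n) (lt_add_one u)
      (by omega)
  obtain ⟨hu13600, hE1, hE2⟩ := hu₀ u hu₀u
  have hu1 : 1 ≤ u := le_trans (by norm_num) hu13600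
  -- `n < T(u+1) ≤ 13600 u⁵`
  have hn_lt : n < 13600 * u ^ 5 := by
    have h2 : u + 1 ≤ 2 * u := by omega
    have h5 : (u + 1) ^ 5 ≤ 32 * u ^ 5 := by
      calc (u + 1) ^ 5 ≤ (2 * u) ^ 5 := Nat.pow_le_pow_left h2 5
        _ = 32 * u ^ 5 := by ring
    have h1' : 1 ≤ u + 1 := by omega
    have h45 : (u + 1) ^ 4 ≤ (u + 1) ^ 5 := Nat.pow_le_pow_right h1' (by norm_num)
    have h35 : (u + 1) ^ 3 ≤ (u + 1) ^ 5 := Nat.pow_le_pow_right h1' (by norm_num)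
    have h15 : (u + 1) ≤ (u + 1) ^ 5 := by
      calc (u + 1) = (u + 1) ^ 1 := (pow_one _).symm
        _ ≤ (u + 1) ^ 5 := Nat.pow_le_pow_right h1' (by norm_num)
    omega
  -- the parameters
  set m : ℕ := u ^ 3 with hm
  set L : ℕ := 8 * m * u + 3 * m with hL
  set K : ℕ := 2 * L + 4 * m + 2 with hK
  set N : ℕ := 2 * n - 2 * L with hN
  have hT : 12 * K * u + 3 * L + 2 * K ≤ n := by
    have : 12 * K * u + 3 * L + 2 * K = 192 * u ^ 5 + 176 * u ^ 4 + 29 * u ^ 3 + 24 * u + 4 := by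
      simp only [hK, hL, hm]; ring
    rw [this]; exact hTu
  have hNle : N ≤ 2 * n := by rw [hN]; omega
  have hNpos : 0 < N := by
    have eT : 12 * K * u = 12 * (K * u) := by ring
    rw [eT] at hT
    rw [hN]; omega
  have hn3 : 3 ≤ n := by omega
  -- real-valued size bounds
  have hur : (1 : ℝ) ≤ u := by exact_mod_cast hu1
  have hnr : (n : ℝ) ≤ 13600 * (u : ℝ) ^ 5 := by exact_mod_cast hn_lt.le
  have hNr : (0 : ℝ) < N := by exact_mod_cast hNpos
  have hN2 : (N : ℝ) ≤ 2 * n := by exact_mod_cast hNle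
  have hNr5 : (N : ℝ) ≤ 27200 * (u : ℝ) ^ 5 := by linarith
  -- the band estimate `2N e^{-m²/(2N)} 2^N ≤ 2^N/(2N)`
  have hband : 2 * (N : ℝ) * Real.exp (-((m : ℝ) ^ 2 / (2 * N))) * 2 ^ N ≤ 2 ^ N / (2 * N) := by
    have h1 : (u : ℝ) / 54400 ≤ (m : ℝ) ^ 2 / (2 * N) := by
      rw [div_le_div_iff₀ (by norm_num) (mul_pos (by norm_num) hNr)]
      have hm6 : (m : ℝ) ^ 2 = (u : ℝ) ^ 6 := by
        rw [hm]; push_cast; ring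
      rw [hm6]
      have : (u : ℝ) * (2 * N) ≤ (u : ℝ) * (54400 * (u : ℝ) ^ 5) := by
        have hu0 : (0 : ℝ) ≤ u := by positivity
        nlinarith
      nlinarith
    have h2 : Real.exp (-((m : ℝ) ^ 2 / (2 * N))) ≤ Real.exp (-(1 / 54400 : ℝ)) ^ u := by
      rw [← Real.exp_nat_mul, Real.exp_le_exp]
      have : (u : ℝ) * -(1 / 54400 : ℝ) = -((u : ℝ) / 54400) := by ring
      rw [this]
      linarith
    have h3 : 4 * (N : ℝ) ^ 2 * Real.exp (-((m : ℝ) ^ 2 / (2 * N))) ≤ 1 := by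
      calc 4 * (N : ℝ) ^ 2 * Real.exp (-((m : ℝ) ^ 2 / (2 * N)))
          ≤ 4 * (27200 * (u : ℝ) ^ 5) ^ 2 * Real.exp (-(1 / 54400 : ℝ)) ^ u := by
            gcongr
        _ = 4 * 27200 ^ 2 * (u : ℝ) ^ 10 * Real.exp (-(1 / 54400 : ℝ)) ^ u := by ring
        _ ≤ 1 := hE1.le
    have hN0 : (N : ℝ) ≠ 0 := hNr.ne'
    rw [show 2 * (N : ℝ) * Real.exp (-((m : ℝ) ^ 2 / (2 * N))) * 2 ^ N
        = (4 * (N : ℝ) ^ 2 * Real.exp (-((m : ℝ) ^ 2 / (2 * N)))) * (2 ^ N / (2 * N)) by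
      field_simp; ring]
    calc (4 * (N : ℝ) ^ 2 * Real.exp (-((m : ℝ) ^ 2 / (2 * N)))) * (2 ^ N / (2 * N))
        ≤ 1 * (2 ^ N / (2 * N)) := by gcongr
      _ = 2 ^ N / (2 * N) := one_mul _
  -- the measure and the spread law
  obtain ⟨μ, hμ1, hμS⟩ := exists_thick_measure_of_le hu1 hm hL hK hN hT hband
  have hmain := hF n hn3 _ μ hμ1 hμS
  push_cast at hmain
  -- `2^u ≤ F n`
  set s : ℕ := F n with hs
  have h2u : (2 : ℝ) ^ u ≤ (s : ℝ) := by
    by_contra hlt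
    rw [not_le] at hlt
    have hpos : (0 : ℝ) < ((n : ℝ) + 1) ^ 2 * (2 * (N : ℝ) * (3 / 4 : ℝ) ^ (4 * u)) := by positivity
    have hlt' : 4 * (s : ℝ) * ((n : ℝ) + 1) ^ 2 * (2 * (N : ℝ) * (3 / 4 : ℝ) ^ (4 * u))
        < 4 * (2 : ℝ) ^ u * ((n : ℝ) + 1) ^ 2 * (2 * (N : ℝ) * (3 / 4 : ℝ) ^ (4 * u)) := by
      have := mul_lt_mul_of_pos_right hlt hpos
      nlinarith
    have hpow : (2 : ℝ) ^ u * (3 / 4 : ℝ) ^ (4 * u) = (81 / 128 : ℝ) ^ u := by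
      rw [pow_mul, ← mul_pow]; norm_num
    have hn1 : (n : ℝ) + 1 ≤ 13601 * (u : ℝ) ^ 5 := by
      have : (1 : ℝ) ≤ (u : ℝ) ^ 5 := one_le_pow₀ hur
      linarith
    have hB : ((n : ℝ) + 1) ^ 2 ≤ (13601 * (u : ℝ) ^ 5) ^ 2 := by gcongr
    have hfin : 4 * (2 : ℝ) ^ u * ((n : ℝ) + 1) ^ 2 * (2 * (N : ℝ) * (3 / 4 : ℝ) ^ (4 * u)) < 1 := by
      calc 4 * (2 : ℝ) ^ u * ((n : ℝ) + 1) ^ 2 * (2 * (N : ℝ) * (3 / 4 : ℝ) ^ (4 * u))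
          = 4 * ((n : ℝ) + 1) ^ 2 * (2 * (N : ℝ)) * ((2 : ℝ) ^ u * (3 / 4 : ℝ) ^ (4 * u)) := by
            ring
        _ = 4 * ((n : ℝ) + 1) ^ 2 * (2 * (N : ℝ)) * (81 / 128 : ℝ) ^ u := by rw [hpow]
        _ ≤ 4 * (13601 * (u : ℝ) ^ 5) ^ 2 * (2 * (27200 * (u : ℝ) ^ 5)) * (81 / 128 : ℝ) ^ u := by
            gcongr
        _ = 4 * 13601 ^ 2 * 54400 * (u : ℝ) ^ 15 * (81 / 128 : ℝ) ^ u := by ring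
        _ < 1 := hE2
    linarith
  -- `n^{1/6} ≤ u`
  have hroot : (n : ℝ) ^ ((1 : ℝ) / 6) ≤ u := by
    have hn6 : (n : ℝ) ≤ (u : ℝ) ^ 6 := by
      have h13600 : (13600 : ℝ) ≤ u := by exact_mod_cast hu13600
      have hu5 : (0 : ℝ) ≤ (u : ℝ) ^ 5 := by positivity
      calc (n : ℝ) ≤ 13600 * (u : ℝ) ^ 5 := hnr
        _ ≤ (u : ℝ) * (u : ℝ) ^ 5 := mul_le_mul_of_nonneg_right h13600 hu5
        _ = (u : ℝ) ^ 6 := by ring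
    have h := Real.rpow_le_rpow (Nat.cast_nonneg n) hn6 (by norm_num : (0 : ℝ) ≤ 1 / 6)
    have h6 : ((u : ℝ) ^ 6) ^ ((1 : ℝ) / 6) = u := by
      rw [show ((1 : ℝ) / 6) = ((6 : ℕ) : ℝ)⁻¹ by norm_num]
      exact Real.pow_rpow_inv_natCast (Nat.cast_nonneg u) (by norm_num)
    rw [h6] at h
    exact h
  calc (2 : ℝ) ^ ((n : ℝ) ^ ((1 : ℝ) / 6)) ≤ (2 : ℝ) ^ ((u : ℕ) : ℝ) :=
        Real.rpow_le_rpow_of_exponent_le (by norm_num) hroot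
    _ = (2 : ℝ) ^ u := Real.rpow_natCast 2 u
    _ ≤ s := h2u

end SpreadLaw

end Summit.ValiantsHypothesis.ValiantsHypothesis.Theorems.FifoMatching

end
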